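import Summits.QuantumFields.YangMills.Theorems.BalabanUVNodesN21SelectedThresholdsHistories

/-!
# YM-DAG node N21 (= NE7c) — THE MODEL-A CONSTRUCTOR OF HISTORY FAMILIES, FOR WHICH (RESUM) IS A THEOREM: the causal factor of a slot in a history, the hierarchical
# partition of unity under CAUSAL liveness, the live-small regions, the remaining density, `modelAWeight γ live u ϑ τ := restFactor_τ · γ`, and
# `Σ_τ histLaw (modelAWeight …) (liveSmall τ) u ϑ = γ` at EVERY threshold vector — lens Card 15 (`LENS-nearmiss.md` v6.0), `Sketch-nearmiss-g6.lean` §E VERBATIM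

Track A of `YM-PLAN.md` (cell `pub-ymgap`, HUMAN RULING D-0062), node **N21**; R134 fan-out seat `pub-ymgap-dag-n21-d` (s2), generation 5, module 20f — DEFINITION LANE (four
`def`s + their bookkeeping theorems; 0 `sorry`, standard axioms; no `instance`, no `notation`; COUNT-NEUTRAL; `--supports` the K3‴ item `SpineGivenEndpointR13`
(stmt-QuantumFields-19912)).  NO Theses import, NO `Node00.Record13` import.  THIS FILE IS the planner seat `ym-lens-BalabanUVNodes-nearmiss` g6's farm-checked sketch
`Sketch-nearmiss-g6.lean` (sha16 0c87d1bc897efdaa) §E VERBATIM with the lens's own rename `histFactor ↦ causalFactor` (homonym: `T4Continuum.ActivityTermBudget.histFactor` is a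
real constant of another lineage) and the namespace renamed (CREDIT: ym-lens-BalabanUVNodes-nearmiss g6, memo `LENS-nearmiss.md` v6.0 5a5eb79e1354f382, Card 15, FAN-OUT ROW A⁗-S).
Imports module 20 `BalabanUVNodesN21SelectedThresholdsHistories` (brings the `pub-balaban` leaf `ShellMeasureRootCompositionHistories`: `smallProd`, `histLaw`,
`measurable_smallProd`; and `ShellMeasureRootCompositionPush.measurable_smallInd`).  Sibling of the theorems-only module 20e `…HistoriesResummation` (ROW A⁗), whose (RESUM)
binder `Σ_τ histLaw^X_τ = γ^X_t` this constructor DISCHARGES.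

THE OBJECTS ([folklore]; model A = lens Card 16: the common space of a comparison is a disjoint union ∕ product carrying each run's own law, one law PER RUN).
* `causalFactor live lab x` — the factor history `τ` assigns to a slot whose small-field indicator has value `x`: LIVE slots carry `x` (label small) or `1 − x` (label
  large); DEAD slots (shadowed by an older large field — not tested, [III] (1.4)∕(1.8)-type causal liveness) carry no factor: label forced to `true` (factor `1`), the
  other label killed (factor `0`) so that histories are not double-counted; `sum_causalFactor`, `causalFactor_nonneg`, `measurable_causalFactor`;
  ★ `sum_prod_causalFactor_eq_one` — for a CAUSAL liveness rule (`live τ i` reads only `τ j`, `j < i`) the products over all label strings sum to `1`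
  (the hierarchical partition of unity).
* `liveSmall live τ` (the live-small region: the leaf's `small τ`), `restFactor live τ u ϑ` (the product of the NON-live-small factors — large-field factors `1 − χ` and dead
  slots), `modelAWeight γ live u ϑ τ := γ.withDensity (ofReal ∘ restFactor_τ)` (the history's weight in the leaf's currency); `restFactor_nonneg`, `measurable_restFactor`,
  `restFactor_mul_smallProd` (remaining density × live-small indicator product = the full factor product), `withDensity_finsetSum'`;
  ★ `sum_histLaw_modelA` — **(RESUM) IS A THEOREM for this constructor**: `Σ_τ histLaw (modelAWeight γ live u ϑ τ) (liveSmall live τ) u ϑ = γ` at EVERY threshold vector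
  `ϑ` (thresholds only move mass between histories) — module 20e's `hres` binder.

HONEST FRAMING (binding).  A CONSTRUCTOR TYPE with its algebra, not Bałaban's expansion: which liveness rule, which statistics `u`, which law `γ` NODE O's term object has is
NODE O's to say (lens (t-n‴)); nothing of Bałaban's asserted or instantiated; NE7c is NOT PRINTED and NOT PROVED; **N21 is NOT discharged**; typed 28∕28, discharged count
untouched; one finite four-torus programme at fixed `ε` — NOT ℝ⁴, NOT infinite volume, NOT OS, NOT a mass gap, NOT Clay.  No decl below carries a cite tag.
-/

set_option autoImplicit false

noncomputable section

open scoped BigOperators ENNReal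
open MeasureTheory Set

namespace Summit.QuantumFields.YangMills.Theorems.N21HistoriesModelADefs

open Literature.MathematicalPhysics.QuantumFieldTheory.Balaban1983to89
open Summit.QuantumFields.BalabanUV.T4Continuum.ShellMeasureRootCompositionHistories (histLaw)

/-! ## §E (RESUM) IS A THEOREM IN MODEL A: the hierarchical partition of unity and the model-A constructor -/

section HistFactor

open Literature.MathematicalPhysics.QuantumFieldTheory.Balaban1983to89.T4IndicatorShell (smallInd smallInd_nonneg smallInd_le_one)
open Summit.QuantumFields.BalabanUV.T4Continuum.ShellMeasureRootCompositionPush (measurable_smallInd)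
open Summit.QuantumFields.BalabanUV.T4Continuum.ShellMeasureRootCompositionHistories (smallProd)

/-- the factor history `τ` assigns to a slot whose small-field indicator has value `x`: LIVE slots carry `x` (label small) or
`1 − x` (label large); DEAD slots (shadowed by an older large field — not tested) carry no factor: label forced to `true`
(factor `1`), the other label killed (factor `0`) so that histories are not double-counted. [folklore] -/
def causalFactor : Bool → Bool → ℝ → ℝ
  | true, true, x => x
  | true, false, x => 1 - x
  | false, true, _ => 1
  | false, false, _ => 0

/-- live ∧ small: the factor is the indicator value. [folklore] -/
@[simp] theorem causalFactor_tt (x : ℝ) : causalFactor true true x = x := rfl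
/-- live ∧ large: the complementary factor. [folklore] -/
@[simp] theorem causalFactor_tf (x : ℝ) : causalFactor true false x = 1 - x := rfl
/-- dead ∧ forced label: factor `1`. [folklore] -/
@[simp] theorem causalFactor_ft (x : ℝ) : causalFactor false true x = 1 := rfl
/-- dead ∧ killed label: factor `0`. [folklore] -/
@[simp] theorem causalFactor_ff (x : ℝ) : causalFactor false false x = 0 := rfl

/-- the two labels of one slot resolve unity. [folklore] -/
theorem sum_causalFactor (live : Bool) (x : ℝ) : causalFactor live true x + causalFactor live false x = 1 := by
  cases live <;> simp

/-- the factor is nonnegative on indicator values in `[0,1]`. [folklore] -/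
theorem causalFactor_nonneg (live lab : Bool) {x : ℝ} (hx0 : 0 ≤ x) (hx1 : x ≤ 1) : 0 ≤ causalFactor live lab x := by
  cases live <;> cases lab <;> simp <;> linarith

/-- the factor is measurable in the indicator value. [folklore] -/
theorem measurable_causalFactor (live lab : Bool) : Measurable (causalFactor live lab) := by
  cases live <;> cases lab
  · exact (measurable_const : Measurable fun _ : ℝ => (0 : ℝ))
  · exact (measurable_const : Measurable fun _ : ℝ => (1 : ℝ))
  · exact (measurable_const.sub measurable_id : Measurable fun x : ℝ => 1 - x)
  · exact (measurable_id : Measurable fun x : ℝ => x)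

/-- **THE HIERARCHICAL PARTITION OF UNITY**: for a CAUSAL liveness rule (`live τ i` reads only the older labels `τ j`, `j < i`) the products of the
factors over all label strings sum to `1`, for every vector of indicator values. [folklore] -/
theorem sum_prod_causalFactor_eq_one : ∀ (n : ℕ) (live : (Fin n → Bool) → Fin n → Bool)
    (_hc : ∀ τ τ' i, (∀ j, j < i → τ j = τ' j) → live τ i = live τ' i) (χ : Fin n → ℝ),
    ∑ τ : Fin n → Bool, ∏ i, causalFactor (live τ i) (τ i) (χ i) = 1
  | 0, live, _, χ => by simp
  | n + 1, live, hc, χ => by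
    rw [← Fintype.sum_equiv (Fin.consEquiv fun _ => Bool)
      (fun p => ∏ i, causalFactor (live (Fin.cons p.1 p.2 : Fin (n + 1) → Bool) i) ((Fin.cons p.1 p.2 : Fin (n + 1) → Bool) i) (χ i))
      (fun τ => ∏ i, causalFactor (live τ i) (τ i) (χ i)) (fun _ => rfl), Fintype.sum_prod_type]
    simp only [Fin.prod_univ_succ, Fin.cons_zero, Fin.cons_succ]
    have h0 : ∀ τ : Fin (n + 1) → Bool, live τ 0 = live (fun _ => true) 0 := fun τ =>
      hc τ _ 0 fun j hj => absurd hj (Nat.not_lt_zero _)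
    have htail : ∀ b : Bool, ∑ τ' : Fin n → Bool, ∏ i : Fin n,
        causalFactor (live (Fin.cons b τ' : Fin (n + 1) → Bool) i.succ) (τ' i) (χ i.succ) = 1 := fun b => by
      refine sum_prod_causalFactor_eq_one n (fun τ' i => live (Fin.cons b τ' : Fin (n + 1) → Bool) i.succ) (fun τ τ' i hτ => ?_)
        fun i => χ i.succ
      refine hc _ _ i.succ fun j hj => ?_
      cases j using Fin.cases with
      | zero => rfl
      | succ j' => simp only [Fin.cons_succ]; exact hτ j' (Fin.succ_lt_succ_iff.1 hj)
    have hsplit : ∀ b : Bool, ∑ τ' : Fin n → Bool, causalFactor (live (Fin.cons b τ' : Fin (n + 1) → Bool) 0) b (χ 0) *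
        ∏ i : Fin n, causalFactor (live (Fin.cons b τ' : Fin (n + 1) → Bool) i.succ) (τ' i) (χ i.succ) =
        causalFactor (live (fun _ => true) 0) b (χ 0) := fun b => by
      simp_rw [h0]
      rw [← Finset.mul_sum, htail b, mul_one]
    simp_rw [hsplit]
    simpa using sum_causalFactor (live (fun _ => true) 0) (χ 0)

/-! ### the model-A constructor: history weights := (the non-live-small factors) · γ; then (RESUM) is a THEOREM -/

section ModelA

variable {Ω : Type*} [MeasurableSpace Ω] {n : ℕ}

/-- the LIVE-SMALL region of history `τ`: live slots labelled small (their indicators are the leaf's `smallProd`). -/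
def liveSmall (live : (Fin n → Bool) → Fin n → Bool) (τ : Fin n → Bool) : Finset (Fin n) :=
  Finset.univ.filter fun i => live τ i = true ∧ τ i = true

/-- the history's REMAINING density: the factors of all slots that are not live-small (large-field factors `1 − χ`, dead slots). -/
def restFactor (live : (Fin n → Bool) → Fin n → Bool) (τ : Fin n → Bool) (u : Fin n → Ω → ℝ) (ϑ : Fin n → ℝ)
    (ω : Ω) : ℝ :=
  ∏ i ∈ Finset.univ.filter (fun i => ¬(live τ i = true ∧ τ i = true)), causalFactor (live τ i) (τ i) (smallInd (u i ω) (ϑ i))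

/-- **MODEL A's HISTORY WEIGHT** `ν_τ := restFactor_τ · γ` (γ = the run's tilted law pulled back to the common space). -/
def modelAWeight (γ : Measure Ω) (live : (Fin n → Bool) → Fin n → Bool) (u : Fin n → Ω → ℝ) (ϑ : Fin n → ℝ)
    (τ : Fin n → Bool) : Measure Ω :=
  γ.withDensity fun ω => ENNReal.ofReal (restFactor live τ u ϑ ω)

omit [MeasurableSpace Ω] in
/-- the remaining density is nonnegative. [folklore] -/
theorem restFactor_nonneg (live : (Fin n → Bool) → Fin n → Bool) (τ : Fin n → Bool) (u : Fin n → Ω → ℝ) (ϑ : Fin n → ℝ)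
    (ω : Ω) : 0 ≤ restFactor live τ u ϑ ω :=
  Finset.prod_nonneg fun _ _ => causalFactor_nonneg _ _ (smallInd_nonneg _ _) (smallInd_le_one _ _)

/-- the remaining density is measurable along measurable statistics. [folklore] -/
theorem measurable_restFactor (live : (Fin n → Bool) → Fin n → Bool) (τ : Fin n → Bool) {u : Fin n → Ω → ℝ}
    (hu : ∀ i, Measurable (u i)) (ϑ : Fin n → ℝ) : Measurable (restFactor live τ u ϑ) := by
  unfold restFactor
  exact Finset.measurable_prod _ fun i _ => (measurable_causalFactor _ _).comp (measurable_smallInd (hu i) (ϑ i))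

omit [MeasurableSpace Ω] in
/-- the full factor product of a history = its remaining density × its live-small indicator product. [folklore] -/
theorem restFactor_mul_smallProd (live : (Fin n → Bool) → Fin n → Bool) (τ : Fin n → Bool) (u : Fin n → Ω → ℝ)
    (ϑ : Fin n → ℝ) (ω : Ω) :
    restFactor live τ u ϑ ω * smallProd (liveSmall live τ) u ϑ ω = ∏ i, causalFactor (live τ i) (τ i) (smallInd (u i ω) (ϑ i)) := by
  have hsm : smallProd (liveSmall live τ) u ϑ ω =
      ∏ i ∈ Finset.univ.filter (fun i => live τ i = true ∧ τ i = true), causalFactor (live τ i) (τ i) (smallInd (u i ω) (ϑ i)) := by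
    unfold smallProd liveSmall
    refine Finset.prod_congr rfl fun i hi => ?_
    obtain ⟨h1, h2⟩ := (Finset.mem_filter.1 hi).2
    simp [h1, h2]
  rw [hsm, restFactor, mul_comm]
  exact Finset.prod_filter_mul_prod_filter_not _ _ _

/-- `withDensity` of a finite sum of measurable densities is the sum of the `withDensity`s. [folklore] -/
theorem withDensity_finsetSum' {ι : Type*} (s : Finset ι) (μ : Measure Ω) (f : ι → Ω → ℝ≥0∞)
    (hf : ∀ i, Measurable (f i)) : μ.withDensity (fun ω => ∑ i ∈ s, f i ω) = ∑ i ∈ s, μ.withDensity (f i) := by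
  classical
  induction s using Finset.induction_on with
  | empty => simp
  | insert a s ha ih =>
    rw [Finset.sum_insert ha]
    simp_rw [Finset.sum_insert ha]
    rw [← ih]
    exact withDensity_add_left (hf a) _

/-- **(RESUM) IS A THEOREM IN MODEL A**: with history weights `ν_τ := restFactor_τ · γ` and live-small regions `liveSmall τ` for a
CAUSAL liveness rule, the histories' laws resum to the tilted law EXACTLY, at every threshold vector `ϑ`:
`Σ_τ histLaw ν_τ (liveSmall τ) u ϑ = γ`.  This is module 20's `hres` binder for the model-A constructor. [folklore] -/
theorem sum_histLaw_modelA (γ : Measure Ω) (live : (Fin n → Bool) → Fin n → Bool)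
    (hc : ∀ τ τ' i, (∀ j, j < i → τ j = τ' j) → live τ i = live τ' i) {u : Fin n → Ω → ℝ} (hu : ∀ i, Measurable (u i))
    (ϑ : Fin n → ℝ) :
    ∑ τ : Fin n → Bool, histLaw (modelAWeight γ live u ϑ τ) (liveSmall live τ) u ϑ = γ := by
  have hterm : ∀ τ : Fin n → Bool, histLaw (modelAWeight γ live u ϑ τ) (liveSmall live τ) u ϑ =
      γ.withDensity fun ω => ENNReal.ofReal (∏ i, causalFactor (live τ i) (τ i) (smallInd (u i ω) (ϑ i))) := fun τ => by
    unfold histLaw modelAWeight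
    rw [← withDensity_mul _ (measurable_restFactor live τ hu ϑ).ennreal_ofReal
      (Summit.QuantumFields.BalabanUV.T4Continuum.ShellMeasureRootCompositionHistories.measurable_smallProd _ hu ϑ).ennreal_ofReal]
    refine congrArg _ (funext fun ω => ?_)
    simp only [Pi.mul_apply]
    rw [← ENNReal.ofReal_mul (restFactor_nonneg live τ u ϑ ω), restFactor_mul_smallProd]
  simp_rw [hterm]
  rw [← withDensity_finsetSum' Finset.univ γ
    (fun τ ω => ENNReal.ofReal (∏ i, causalFactor (live τ i) (τ i) (smallInd (u i ω) (ϑ i))))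
    fun τ => (Finset.measurable_prod _ fun i _ =>
      (measurable_causalFactor (live τ i) (τ i)).comp (measurable_smallInd (hu i) (ϑ i))).ennreal_ofReal]
  have h1 : (fun ω => ∑ τ : Fin n → Bool, ENNReal.ofReal (∏ i, causalFactor (live τ i) (τ i) (smallInd (u i ω) (ϑ i)))) = 1 := by
    funext ω
    rw [← ENNReal.ofReal_sum_of_nonneg fun τ _ => Finset.prod_nonneg fun i _ =>
      causalFactor_nonneg _ _ (smallInd_nonneg _ _) (smallInd_le_one _ _),
      sum_prod_causalFactor_eq_one n live hc, ENNReal.ofReal_one]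
    rfl
  rw [h1, withDensity_one]

end ModelA


end HistFactor

end Summit.QuantumFields.YangMills.Theorems.N21HistoriesModelADefs

end
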